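import Literature.AlgebraicGeometry.Frobenioids.EquivalenceThm34OfThm34ii
import Literature.AnabelianGeometry.EtaleTheta.BiKummerOfModelCanonical
import Literature.AnabelianGeometry.EtaleTheta.BiKummerRoots
import Literature.AnabelianGeometry.EtaleTheta.Discharge.Sec3Cor38StdIsoNotGL
import Literature.AnabelianGeometry.EtaleTheta.Discharge.Sec5Prop51Example39Pins

/-!
# [EtTh] §5 discharge: Proposition 5.1 — the last vocabulary pin "hypotheses of Theorem 4.4" made REAL,
# derived at the Example 3.9 (iv) Frobenioid, and bridged to the §4 setting

Mochizuki, *The étale theta function and its Frobenioid-theoretic manifestations*, Publ. RIMS **45** (2009),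
Prop. 5.1 p. 323 (PDF p. 97) [cite: MochizukiEtTh2009, Prop 5.1 p.323 (PDF p.97)]: "The Frobenioid `C` is a tempered
Frobenioid of rationally standard type over a slim base category `D`, whose monoid type is `ℤ`, and whose divisor
monoid `Φ(−)` is perfect, perf-factorial, non-dilating, and cuspidally pure. In particular, `C` and the
self-equivalence `Ψ : C ⥲ C` satisfy all of the hypotheses of Corollary 3.8, (i), (ii), (iii); Theorem 4.4 [for
'`C₁`', '`C₂`', '`Ψ : C₁ ⥲ C₂`']"; Thm. 4.4 p. 319 (PDF p. 93): "`C_i` … whose divisor monoid `Φ_i` is … non-dilating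
… `Ψ : C₁ ⥲ C₂` which induces … an equivalence `Ψ^bs : D₁ ⥲ D₂` that maps `A_{⊙,1}^bs` to an isomorph of `A_{⊙,2}^bs`";
§4 preamble p. 312 (PDF p. 86): "whose base category `D` is of the form `D := D₀[𝒟] (⊆ D₀)` … `A_⊙^bs … Galois … thus
determines normal open subgroups `H_⊙ ⊆ Π^tp_X`"; §5 p. 322–323 (PDF pp. 96–97): "we take the object `A_⊚` of the
theory of §4 to be the [Frobenius-trivial] object defined by the trivial line bundle over … `Ÿ` … Observe that this
`A_⊚^bs` is 'characteristic' — that is to say, it is preserved by arbitrary self-equivalences of `D` [cf.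
Propositions 2.4, 2.6] — hence, in particular, Galois."  abc-iut cell, layer L2, seat abc-iut-L2-t9 (gen 3; unit
W2-L2-05 lineage = author of `VocabParams` / `thetaVocab` / `applicability_of_model` / `mkOfModelCanonical`),
node EtTh:Prop5.1, plan/L2 MERGE-PLAN row 3 ("3 pins") — the LAST open pin after abc-iut-w6-d062's
`Discharge/Sec5Prop51Example39Pins.lean` (two pins real: "rationally standard type", "hypotheses of Cor. 3.8").
PROOF-ONLY (no `def`); nothing landed is edited or restated; the pin is a STRUCTURE LITERAL of `VocabParams`.

WHAT IS PROVED.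
* `TemperedFrobenioid.exists_baseEquiv_treeCatVocab` — **"`Ψ` induces an equivalence `Ψ^bs : D ⥲ D`"** (the
  Thm. 4.4 hypothesis on `Ψ`), for ANY tempered Frobenioid `C` at the canonical [FrdI] vocabulary over a SLIM base
  of FSMFF-type with `Φ` non-dilating and ANY self-equivalence `Ψ`: [FrdI] Thm. 3.4 (v) (`Ψ^Base`, `1`-unique,
  an equivalence — abc-iut-L1's `FrdI.thm34v_of_thm34ii`) applied to the operations of `C`, hypothesis (a) "standard
  type" being Thm. 3.7 (ii) (`opsData_isOfStandardType_treeCatVocab`), hypothesis (b) VACUOUS ("not of group-like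
  type", Thm. 3.7 (i), `opsData_not_isOfGroupLikeType`), hypothesis (c) = `D` slim; GIVEN the 0-ary named fact
  `h34 := FrdI.Thm34ii` ([FrdI] Thm. 3.4 (ii), F-0711 — a THEOREM of the tree, `FrdI.Thm34ii_holds`, consumed by
  name exactly as in the Cor. 3.8 knits) and the standing residual `hBmon` ([FrdI] Thm. 5.2 preamble).
* `TemperedFrobenioid.hypothesesThm44_treeCatVocab` — the pinned clause **"`C` and `Ψ` satisfy the hypotheses of
  Theorem 4.4" that concern the pair `(C, Ψ)`**: `Φ` non-dilating (in the shape of abc-iut-L2-t3's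
  `Thm44Hyp.isNonDilating_i`) AND `Ψ` induces some `Ψ^bs : D ⥲ D` with `Base ∘ Ψ ≅ Ψ^bs ∘ Base` (the shape of
  `Thm44Hyp.Ψbs` / `Thm44Hyp.comm`) — DERIVED under the same inputs.
* `BiKummerSetting.exists_thm44Hyp_self` / `…_of_characteristic` — the DICTIONARY with abc-iut-L2-t3's OWN typing:
  for a §4 setting `S` and a self-equivalence `Ψ` of its Frobenioid, the pinned `(C, Ψ)`-clauses together with the
  §4-SETTING clauses — "`D = D₀[𝒟]`" (`Thm44Hyp.baseShape`), "`H_⊙` open" (`isOpen_Hodot`), and print's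
  "`A_⊚^bs` is characteristic: preserved by arbitrary self-equivalences of `D`" (p. 322–323, the binder `hchar`,
  [cf. Props. 2.4, 2.6] — an anabelian input, NOT proved here) — give `∃ hh : Thm44Hyp S S, hh.Ψ = Ψ`;
  `exists_thm44Hyp_mkOfModelCanonical_treeCatVocab` — the same at abc-iut-L2-t9's canonical model instance
  `mkOfModelCanonical X C …` with the `(C, Ψ)`-clauses DISCHARGED.
* `Example39Data.hypothesesThm44_thetaFrobenioid` — **the last pin DERIVED at `C₀ := E.thetaFrobenioid α h`**, the
  tempered Frobenioid of Example 3.9 (iv): "non-dilating" is Example 3.9 (iii)/(iv) (abc-iut-w6-d062's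
  `isNonDilating_Φα`), "`D_α` slim / of FSMFF-type" are Rmk. 3.7.2 for `D_W` (abc-iut-L2-t9's `isSlim_Dα`,
  abc-iut-w6-d062's `isOfFSMFFType_Dα`); inputs {`h34`, `hBmon`, `hW`, `hWf`}.
* `Example39Data.applicability_of_example39_allPins` — **Proposition 5.1 for §5 data over the Example 3.9 (iv)
  Frobenioid with ALL THREE vocabulary pins REAL and DERIVED**: abc-iut-w6-d062's `applicability_of_example39_pinned`
  with its free pin `H44` := the literal `(C, Ψ)`-clause above, now a theorem; residual named inputs exactly
  {`hW`, `hWf` (Rmk. 3.7.2), `hZ` (`Λ = ℤ`), `hcp` (F-0615), `hBmon`, `hrat`, `hKfix` (G-w5d250-1), `h34` (F-0711)}.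
* `Example39Data.exists_thm44Hyp_thetaFrobenioid` — at the §5 bi-Kummer setting over `C₀` (abc-iut-L2-t9's
  `mkOfModelCanonical`; "`Φ` perfect" = `isPerfect_Φα`; Galois data, `(N,H)`-saturation and `A_⊚` parameters, as in
  abc-iut-L2-t4's pre-temperoid §5 files) abc-iut-L2-t3's `Thm44Hyp S S` with underlying `Ψ` EXISTS modulo the three
  §4-setting clauses {`hshape`, `hopen`, `hchar`}.
* FAITHFULNESS RECORD for the base-shape clause at the Example 3.9 (iv) data (`Thm44Hyp.baseShape_i` reads "`D_i :=
  B^temp(X_i^log)[𝒟_i]`" as: `Base : D_i ⥤ D₀` FULL, faithful, essential image `D₀[𝒟]`, relative to the reference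
  category `D₀` of the §3 data): for `D_α → D_W` (`toDW α` = inclusion `(D_W)_B[α] ⊆ (D_W)_B` then `Over.forget`)
  the clauses "faithful" (`toDW_faithful`) and "essential image = `D_W[A]`" (`essImage_toDW_iff`) HOLD, while "full"
  forces every `D_W`-endomorphism of `A` to fix `α` (`comp_eq_self_of_full_toDW`; at `α = 𝟙_A`, the §5 case p. 322,
  `End_{D_W}(A) = {𝟙}`: `eq_id_of_full_toDW_id`) — i.e. at the Example 3.9 (iv) data the typed clause is met only
  when "`A`" has no non-trivial endomorphism over `W` (print, §5 p. 322, silently re-bases to `D₀ := B^temp(A^log)⁰ ≅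
  (D_W)_A`, "`D_X` … special cases of `D_α`", p. 311).  The fullness caveat was raised independently by abc-iut-w6-d062
  (INFO 2026-08-26T07:37:23Z) and is kernel-certified here; hence the pin keeps ONLY the `(C, Ψ)`-clauses and the base
  shape stays the explicit §4-setting binder `hshape`.  Recorded for the owners' v-next census (abc-iut-L2-t3); no
  statement is changed here.  (`hBmon` becomes removable through abc-iut-f-132's `Sec3Cor38StdIsoNotGLUnconditional`
  once built; not imported here.)

HONEST FRAMING: reductions and constructions over abc-iut-L2-t3's DATA structures (`Example39Data`,
`TemperedFrobenioid`, `BiKummerSetting`) and abc-iut-L2-t4's §5 DATA; nothing asserts these data exist for an actual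
curve; the anabelian sentence "`A_⊚^bs` is characteristic" stays the binder `hchar`; [EtTh] is refereed and nothing
here bears on [IUTchIII] Cor. 3.12 — no side is taken; typed ≠ proved — here PROVED modulo the displayed inputs.
-/

namespace Literature.AnabelianGeometry.EtaleTheta

open CategoryTheory Opposite Literature.AlgebraicGeometry.Frobenioids FrobenioidTheta TemperedFrobenioid

universe u₀ v₀ u v w

/-! ### 1. "`Ψ` induces `Ψ^bs : D ⥲ D`" for a tempered Frobenioid (Thm. 4.4 hypothesis; [FrdI] Thm. 3.4 (v)) -/

namespace TemperedFrobenioid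

section TreeVocab

variable {D₀ : Type u₀} [Category.{v₀} D₀] {T : RealifiedDivisorMonoids (D₀ := D₀) treeMonoidVocab.{w}}
  {D : Type u} [Category.{v} D] {IsRational IsStrictlyRational : (Dᵒᵖ ⥤ CommMonCat.{w}) → Prop}
  (C : TemperedFrobenioid T D (treeCatVocab D IsRational IsStrictlyRational))

/-- **"`Ψ` … induces … an equivalence `Ψ^bs : D ⥲ D`"** (the hypothesis of Thm. 4.4 on `Ψ`, p. 319 (PDF p. 93)),
DERIVED for every self-equivalence `Ψ` of a tempered Frobenioid at the canonical vocabulary over a slim base of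
FSMFF-type with non-dilating `Φ`: [FrdI] Thm. 3.4 (v) — (a) standard type by Thm. 3.7 (ii), (b) vacuous (not of
group-like type, Thm. 3.7 (i)), (c) `D` slim — gives the `1`-unique equivalence `Ψ^Base` with
`Base ∘ Ψ ≅ Ψ^Base ∘ Base`; GIVEN `h34 := FrdI.Thm34ii` (F-0711) and `hBmon`.
[cite: MochizukiEtTh2009, Thm 4.4 p.319 (PDF p.93)] -/
theorem exists_baseEquiv_treeCatVocab (h34 : FrdI.Thm34ii.{w, v, max v w, u, max u w})
    (hBmon : IsMonoidOn C.ratFnFunctor) (hD : IsOfFSMFFType D)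
    (hnd : ∀ (A : Dᵒᵖ) (f : A ⟶ A), treeMonoidVocab.{w}.IsNonDilating (C.Φ.carrier A) (C.Φ.pull f))
    (hs : IsSlim D) (Ψ : C.category ≌ C.category) :
    ∃ Ψbs : D ≌ D, Nonempty (C.baseFunctorOfCategory ⋙ Ψbs.functor ≅ Ψ.functor ⋙ C.baseFunctorOfCategory) := by
  have hF := C.isFrobenioid_treeCatVocab_of_isMonoidOn hBmon
  have hstd := C.opsData_isOfStandardType_treeCatVocab hBmon hD hnd
  have hB : PreFrobenioidData.HypB C.opsData C.opsData Ψ :=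
    fun hgl _ => absurd hgl C.opsData_not_isOfGroupLikeType
  obtain ⟨-, -, ΨB, ⟨hEq, ⟨e⟩, -⟩, -, -⟩ :=
    FrdI.thm34v_of_thm34ii h34 C.toElem C.toElem hF hF Ψ hstd hstd hB hs hs
  exact ⟨ΨB.asEquivalence, ⟨e.symm⟩⟩

/-- **The pin "`C` and `Ψ` satisfy all of the hypotheses of Theorem 4.4", the clauses on the pair `(C, Ψ)`,
DERIVED** at the canonical vocabulary: "`Φ` non-dilating" (shape of abc-iut-L2-t3's `Thm44Hyp.isNonDilating_i`)
and "`Ψ` induces `Ψ^bs : D ⥲ D` with `Base ∘ Ψ ≅ Ψ^bs ∘ Base`" (shape of `Thm44Hyp.Ψbs`, `Thm44Hyp.comm`), for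
`D` slim of FSMFF-type; GIVEN `h34`, `hBmon`. [cite: MochizukiEtTh2009, Prop 5.1 p.323 (PDF p.97)] -/
theorem hypothesesThm44_treeCatVocab (h34 : FrdI.Thm34ii.{w, v, max v w, u, max u w})
    (hBmon : IsMonoidOn C.ratFnFunctor) (hD : IsOfFSMFFType D)
    (hnd : ∀ (A : Dᵒᵖ) (f : A ⟶ A), treeMonoidVocab.{w}.IsNonDilating (C.Φ.carrier A) (C.Φ.pull f))
    (hs : IsSlim D) (Ψ : C.category ≌ C.category) :
    (∀ (A : Dᵒᵖ) (f : A ⟶ A), treeMonoidVocab.{w}.IsNonDilating (C.Φ.carrier A) (C.Φ.pull f)) ∧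
      ∃ Ψbs : D ≌ D, Nonempty (C.baseFunctorOfCategory ⋙ Ψbs.functor ≅ Ψ.functor ⋙ C.baseFunctorOfCategory) :=
  ⟨hnd, C.exists_baseEquiv_treeCatVocab h34 hBmon hD hnd hs Ψ⟩

end TreeVocab

end TemperedFrobenioid

/-! ### 2. Dictionary with abc-iut-L2-t3's `Thm44Hyp`: pinned `(C, Ψ)`-clauses + §4-setting clauses -/

namespace BiKummerSetting

section Generic

variable {K : Type u₀} [Field K] {X : SemiGraphs.TemperedArithmeticGroup.{u₀} K} {D₀ : Type u₀}
  [Category.{v₀} D₀] {V : FrdIMonoidStub.{w}} {T : RealifiedDivisorMonoids (D₀ := D₀) V}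
  {D : Type u} [Category.{v} D] {VD : FrdICatStub.{u, v, w} D} (S : BiKummerSetting X T D VD)

/-- **The hypotheses of Theorem 4.4 for `("C₁", "C₂", "Ψ : C₁ ⥲ C₂") := (C, C, Ψ)` in abc-iut-L2-t3's typing
`Thm44Hyp S S`, ASSEMBLED** from: the `(C, Ψ)`-clauses of Prop. 5.1's pin ("`Φ` non-dilating"; `Ψ^bs` with
`Base ∘ Ψ ≅ Ψ^bs ∘ Base`), the §4-setting clauses "`D = D₀[𝒟]`" (`hshape`, p. 312) and "`H_⊙` open" (`hopen`,
p. 312), and "`Ψ^bs` maps `A_⊙^bs` to an isomorph of `A_⊙^bs`" (`hA`, p. 319).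
[cite: MochizukiEtTh2009, Thm 4.4 p.319 (PDF p.93)] -/
theorem exists_thm44Hyp_self (Ψ : S.C ≌ S.C)
    (hnd : ∀ (A : Dᵒᵖ) (φ : A ⟶ A), V.IsNonDilating (S.tf.Φ.carrier A) (S.tf.Φ.pull φ))
    (hshape : S.tf.base.Full ∧ S.tf.base.Faithful ∧
      ∃ 𝒟 : D₀, ∀ Y : D₀, (∃ A : D, Nonempty (S.tf.base.obj A ≅ Y)) ↔ Nonempty (Y ⟶ 𝒟))
    (hopen : IsOpen (S.Hodot : Set X.Pi)) (Ψbs : D ≌ D) (comm : S.base ⋙ Ψbs.functor ≅ Ψ.functor ⋙ S.base)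
    (hA : IsIsomorph (Ψbs.functor.obj (S.base.obj S.Aodot)) (S.base.obj S.Aodot)) :
    ∃ hh : Thm44Hyp S S, hh.Ψ = Ψ :=
  ⟨⟨hnd, hnd, hshape, hshape, hopen, hopen, Ψ, Ψbs, comm, hA⟩, rfl⟩

/-- The same with the `A_⊙`-clause in print's §5 form **"`A_⊚^bs` is 'characteristic' — that is to say, it is
preserved by arbitrary self-equivalences of `D`"** (p. 322–323, [cf. Props. 2.4, 2.6]; binder `hchar`) and the
`Ψ^bs`-clause as the bare existence the pin asserts. [cite: MochizukiEtTh2009, §5 p.322–323 (PDF pp.96–97)] -/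
theorem exists_thm44Hyp_self_of_characteristic (Ψ : S.C ≌ S.C)
    (hnd : ∀ (A : Dᵒᵖ) (φ : A ⟶ A), V.IsNonDilating (S.tf.Φ.carrier A) (S.tf.Φ.pull φ))
    (hshape : S.tf.base.Full ∧ S.tf.base.Faithful ∧
      ∃ 𝒟 : D₀, ∀ Y : D₀, (∃ A : D, Nonempty (S.tf.base.obj A ≅ Y)) ↔ Nonempty (Y ⟶ 𝒟))
    (hopen : IsOpen (S.Hodot : Set X.Pi))
    (hbs : ∃ Ψbs : D ≌ D, Nonempty (S.base ⋙ Ψbs.functor ≅ Ψ.functor ⋙ S.base))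
    (hchar : ∀ Θ : D ≌ D, IsIsomorph (Θ.functor.obj (S.base.obj S.Aodot)) (S.base.obj S.Aodot)) :
    ∃ hh : Thm44Hyp S S, hh.Ψ = Ψ := by
  obtain ⟨Ψbs, ⟨comm⟩⟩ := hbs
  exact S.exists_thm44Hyp_self Ψ hnd hshape hopen Ψbs comm (hchar Ψbs)

/-- Conversely, abc-iut-L2-t3's `Thm44Hyp S S` yields the pinned `(C, Ψ)`-clauses for its own `Ψ` (so the pin
loses nothing of the typed hypothesis on the pair). [cite: MochizukiEtTh2009, Thm 4.4 p.319 (PDF p.93)] -/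
theorem hypothesesThm44_of_thm44Hyp (hh : Thm44Hyp S S) :
    (∀ (A : Dᵒᵖ) (φ : A ⟶ A), V.IsNonDilating (S.tf.Φ.carrier A) (S.tf.Φ.pull φ)) ∧
      ∃ Ψbs : D ≌ D, Nonempty (S.base ⋙ Ψbs.functor ≅ hh.Ψ.functor ⋙ S.base) :=
  ⟨hh.isNonDilating₁, hh.Ψbs, ⟨hh.comm⟩⟩

end Generic

section TreeVocab

variable {K : Type u₀} [Field K] (X : SemiGraphs.TemperedArithmeticGroup.{u₀} K) {D₀ : Type u₀}
  [Category.{v₀} D₀] {T : RealifiedDivisorMonoids (D₀ := D₀) treeMonoidVocab.{w}}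
  {D : Type u} [Category.{v} D] {IsRational IsStrictlyRational : (Dᵒᵖ ⥤ CommMonCat.{w}) → Prop}
  (C : TemperedFrobenioid T D (treeCatVocab D IsRational IsStrictlyRational))
  (hZ : C.monoidType = MonoidType.Z) (hP : ∀ A : Dᵒᵖ, IsPerfect (C.Φ.carrier A)) (IG : D → Prop)
  (gS : ∀ A : D, IG A → (X.Pi →* Aut A)) (gSs : ∀ (A : D) (h : IG A), Function.Surjective (gS A h))
  (NH : Subgroup (Field.absoluteGaloisGroup K) → C.category → ℕ+ → Prop) (A₀ : C.category)
  (hA₀ : PreFrobenioid.IsFrobeniusTrivial C.toElem A₀) (hA₀' : IG A₀.base)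

/-- **`Thm44Hyp S S` at abc-iut-L2-t9's canonical §4 model instance `S := mkOfModelCanonical X C …`** over a
tempered Frobenioid at the canonical vocabulary (slim base of FSMFF-type, `Φ` non-dilating), for every
self-equivalence `Ψ`: the `(C, Ψ)`-clauses are DISCHARGED (`hypothesesThm44_treeCatVocab`); residual = the
§4-setting clauses {`hshape` "`D = D₀[𝒟]`", `hopen` "`H_⊙` open", `hchar` "`A_⊙^bs` characteristic"} and the named
inputs {`h34`, `hBmon`}. [cite: MochizukiEtTh2009, Thm 4.4 p.319 (PDF p.93)] -/
theorem exists_thm44Hyp_mkOfModelCanonical_treeCatVocab (h34 : FrdI.Thm34ii.{w, v, max v w, u, max u w})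
    (hBmon : IsMonoidOn C.ratFnFunctor) (hD : IsOfFSMFFType D)
    (hnd : ∀ (A : Dᵒᵖ) (f : A ⟶ A), treeMonoidVocab.{w}.IsNonDilating (C.Φ.carrier A) (C.Φ.pull f))
    (hs : IsSlim D)
    (hshape : C.base.Full ∧ C.base.Faithful ∧
      ∃ 𝒟 : D₀, ∀ Y : D₀, (∃ A : D, Nonempty (C.base.obj A ≅ Y)) ↔ Nonempty (Y ⟶ 𝒟))
    (hopen : IsOpen ((mkOfModelCanonical X C hZ hP IG gS gSs NH A₀ hA₀ hA₀').Hodot : Set X.Pi))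
    (hchar : ∀ Θ : D ≌ D, IsIsomorph (Θ.functor.obj A₀.base) A₀.base)
    (Ψ : C.category ≌ C.category) :
    ∃ hh : Thm44Hyp (mkOfModelCanonical X C hZ hP IG gS gSs NH A₀ hA₀ hA₀')
      (mkOfModelCanonical X C hZ hP IG gS gSs NH A₀ hA₀ hA₀'), hh.Ψ = Ψ :=
  (mkOfModelCanonical X C hZ hP IG gS gSs NH A₀ hA₀ hA₀').exists_thm44Hyp_self_of_characteristic Ψ hnd hshape
    hopen (C.exists_baseEquiv_treeCatVocab h34 hBmon hD hnd hs Ψ) hchar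

end TreeVocab

end BiKummerSetting

/-! ### 3. Example 3.9 (iv): the last pin derived; Proposition 5.1 with all three pins REAL -/

namespace Example39Data

section TreeVocab

variable {DW : Type u} [Category.{v} DW] {TW : RealifiedDivisorMonoids (D₀ := DW) treeMonoidVocab.{w}}
  (E : Example39Data treeMonoidVocab.{w} DW TW) {A B : DW} (α : A ⟶ B)
  {IsRational IsStrictlyRational : ((Dα α)ᵒᵖ ⥤ CommMonCat.{w}) → Prop}

/-- **The last pin of Proposition 5.1 — "`C` and `Ψ` satisfy all of the hypotheses of Theorem 4.4" — REAL and
DERIVED at the Example 3.9 (iv) Frobenioid `C₀ := E.thetaFrobenioid α h`**: `Φ_α^ell` non-dilating (Example 3.9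
(iii)/(iv), abc-iut-w6-d062's `isNonDilating_Φα`) and every self-equivalence `Ψ` induces `Ψ^bs : D_α ⥲ D_α` with
`Base ∘ Ψ ≅ Ψ^bs ∘ Base` ([FrdI] Thm. 3.4 (v) over `D_α` slim — `isSlim_Dα` — and of FSMFF-type —
`isOfFSMFFType_Dα` —, Rmk. 3.7.2 for `D_W`); GIVEN {`h34` (F-0711), `hBmon`, `hW`, `hWf`}.
[cite: MochizukiEtTh2009, Prop 5.1 p.323 (PDF p.97)] -/
theorem hypothesesThm44_thetaFrobenioid
    (h : E.FrobenioidHyp α (treeCatVocab (Dα α) IsRational IsStrictlyRational))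
    (h34 : FrdI.Thm34ii.{w, v, max v w, max u v, max (max u v) w})
    (hBmon : IsMonoidOn (E.thetaFrobenioid α h).ratFnFunctor) (hW : IsSlim DW) (hWf : IsOfFSMType DW)
    (Ψ : (E.thetaFrobenioid α h).category ≌ (E.thetaFrobenioid α h).category) :
    (∀ (Y : (Dα α)ᵒᵖ) (f : Y ⟶ Y), treeMonoidVocab.{w}.IsNonDilating ((E.thetaFrobenioid α h).Φ.carrier Y)
        ((E.thetaFrobenioid α h).Φ.pull f)) ∧
      ∃ Ψbs : Dα α ≌ Dα α, Nonempty ((E.thetaFrobenioid α h).baseFunctorOfCategory ⋙ Ψbs.functor ≅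
        Ψ.functor ⋙ (E.thetaFrobenioid α h).baseFunctorOfCategory) :=
  (E.thetaFrobenioid α h).hypothesesThm44_treeCatVocab h34 hBmon (isOfFSMFFType_Dα α hWf)
    (fun Y f => E.isNonDilating_Φα α Y f) (isSlim_Dα α hW) Ψ

/-- **Proposition 5.1 for §5 data over the Example 3.9 (iv) Frobenioid with ALL THREE vocabulary pins REAL and
DERIVED.**  abc-iut-L2-t9's `VocabParams` with: "rationally standard type" := [FrdI] Def. 4.5 (iii) at
`PreFrobenioid.rsParams` (abc-iut-w6-d062); "hypotheses of Cor. 3.8" := `∃ hh : Cor38Hyp C₀ C₀, hh.Ψ = Ψ'`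
(abc-iut-w6-d062); **"hypotheses of Thm. 4.4" := "`Φ` non-dilating ∧ `Ψ'` induces some `Ψ^bs : D_α ⥲ D_α` with
`Base ∘ Ψ' ≅ Ψ^bs ∘ Base`"** (this file) — all three THEOREMS at `C₀`.  For every §5 datum `𝔉` whose
Frobenioid-level part is that of `C₀` and every self-equivalence `Ψ`, abc-iut-L2-t4's `ApplicabilityOfGeneralTheory`
holds GIVEN the named inputs {`hW`, `hWf` (Rmk. 3.7.2: `D_W` slim, of FSM-type), `hZ` (`Λ = ℤ`), `hcp` (F-0615
`Example39_iv_cuspidallyPure`), `hBmon` ([FrdI] Thm. 5.2 preamble), `hrat` (Def. 3.6 (ii) "`Φ` rational"), `hKfix`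
(G-w5d250-1), `h34` (F-0711)} — no free pin left. [cite: MochizukiEtTh2009, Prop 5.1 p.323 (PDF p.97)] -/
theorem applicability_of_example39_allPins
    (h : E.FrobenioidHyp α (treeCatVocab (Dα α) IsRational IsStrictlyRational))
    (h34 : FrdI.Thm34ii.{w, v, max v w, max u v, max (max u v) w})
    (hBmon : IsMonoidOn (E.thetaFrobenioid α h).ratFnFunctor)
    (hW : IsSlim DW) (hWf : IsOfFSMType DW) (hZ : TW.Λ = MonoidType.Z)
    (hcp : E.Example39_iv_cuspidallyPure α h)
    (hrat : ∀ Y : (E.thetaFrobenioid α h).category,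
      PreFrobenioidData.IsRational
        (PreFrobenioid.biratData ((E.thetaFrobenioid α h).isFrobenioid_treeCatVocab_of_isMonoidOn hBmon)
          (PreFrobenioid.hasBiratSquares_of_isFrobenioid
            ((E.thetaFrobenioid α h).isFrobenioid_treeCatVocab_of_isMonoidOn hBmon)))
        (S := PreFrobenioidData.ofFunctor (E.thetaFrobenioid α h).divisorMonoid (E.thetaFrobenioid α h).toElem)
        (fun a 𝔭 => PrimarySupp a 𝔭) Y)
    (hKfix : ∀ (Y : Dα α) (f : Y ≅ Y) (b : TW.BΛ.obj ((E.thetaFrobenioid α h).baseOp (op Y)))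
      (ξ : Algebra.GrothendieckGroup ((E.thetaFrobenioid α h).Φ.carrier (op Y))),
      b ∈ TW.FΛ ((E.thetaFrobenioid α h).baseOp (op Y)) → (b, ξ) ∈ (E.thetaFrobenioid α h).ratFn (op Y) →
        pullGp (E.thetaFrobenioid α h).divisorMonoid f.hom ξ = ξ)
    (𝔉 : ThetaFrobenioid.{w} (E.thetaFrobenioid α h).category (Dα α))
    {hΦ : ∀ Y : (Dα α)ᵒᵖ, IsIntegral ((E.thetaFrobenioid α h).Φ.carrier Y)}
    {IsBFT : MorphismProperty (E.thetaFrobenioid α h).category}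
    (h𝔉 : 𝔉.toTemperedFrobenioidStub = (E.thetaFrobenioid α h).thetaStub hΦ IsBFT)
    (Ψ : (E.thetaFrobenioid α h).category ≌ (E.thetaFrobenioid α h).category) :
    FrobenioidThetaBiKummer.ApplicabilityOfGeneralTheory 𝔉
      (thetaVocab 𝔉
        { IsRationallyStandard :=
            (PreFrobenioidData.ofFunctor (E.thetaFrobenioid α h).divisorMonoid
                (E.thetaFrobenioid α h).toElem).IsOfRationallyStandardType
              (PreFrobenioid.rsParams ((E.thetaFrobenioid α h).isFrobenioid_treeCatVocab_of_isMonoidOn hBmon)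
                fun a 𝔭 => PrimarySupp a 𝔭)
          HypothesesCor38 := fun Ψ' => ∃ hh : Cor38Hyp (E.thetaFrobenioid α h) (E.thetaFrobenioid α h), hh.Ψ = Ψ'
          HypothesesThm44 := fun Ψ' =>
            (∀ (Y : (Dα α)ᵒᵖ) (f : Y ⟶ Y), treeMonoidVocab.{w}.IsNonDilating
                ((E.thetaFrobenioid α h).Φ.carrier Y) ((E.thetaFrobenioid α h).Φ.pull f)) ∧
              ∃ Ψbs : Dα α ≌ Dα α, Nonempty ((E.thetaFrobenioid α h).baseFunctorOfCategory ⋙ Ψbs.functor ≅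
                Ψ'.functor ⋙ (E.thetaFrobenioid α h).baseFunctorOfCategory) })
      Ψ :=
  E.applicability_of_example39_pinned α h hBmon hW hWf hZ hcp hrat hKfix _ 𝔉 h𝔉 Ψ
    (E.hypothesesThm44_thetaFrobenioid α h h34 hBmon hW hWf Ψ)

end TreeVocab

/-! ### 4. The §5 bi-Kummer setting over `C₀` (abc-iut-L2-t9's `mkOfModelCanonical`): `Thm44Hyp` itself -/

section Setting

variable {K : Type u} [Field K] (X : SemiGraphs.TemperedArithmeticGroup.{u} K)
  {DW : Type u} [Category.{v} DW] {TW : RealifiedDivisorMonoids (D₀ := DW) treeMonoidVocab.{w}}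
  (E : Example39Data treeMonoidVocab.{w} DW TW) {A B : DW} (α : A ⟶ B)
  {IsRational IsStrictlyRational : ((Dα α)ᵒᵖ ⥤ CommMonCat.{w}) → Prop}

/-- **abc-iut-L2-t3's `Thm44Hyp S S` for the §5 bi-Kummer setting over the Example 3.9 (iv) Frobenioid**
(`S := mkOfModelCanonical X C₀ …`, "monoid type `ℤ`" = `hZ`, "`Φ` perfect" = Example 3.9 (iii)/(iv)
`isPerfect_Φα`; the Galois objects of `D_α` with `Π^tp_X ↠ Aut(−)`, the `(N,H)`-saturation predicate and the object
`A_⊚` — §5: "the trivial line bundle over `Ÿ`", p. 322 — are parameters), for every self-equivalence `Ψ`: EXISTS with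
underlying `Ψ`, the `(C, Ψ)`-clauses being DISCHARGED; residual = the §4-setting clauses {`hshape`, `hopen`, `hchar`}
and {`h34`, `hBmon`, `hW`, `hWf`}. [cite: MochizukiEtTh2009, Prop 5.1 p.323 (PDF p.97)] -/
theorem exists_thm44Hyp_thetaFrobenioid
    (h : E.FrobenioidHyp α (treeCatVocab (Dα α) IsRational IsStrictlyRational))
    (hZ : TW.Λ = MonoidType.Z) (IG : Dα α → Prop) (gS : ∀ Y : Dα α, IG Y → (X.Pi →* Aut Y))
    (gSs : ∀ (Y : Dα α) (hY : IG Y), Function.Surjective (gS Y hY))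
    (NH : Subgroup (Field.absoluteGaloisGroup K) → (E.thetaFrobenioid α h).category → ℕ+ → Prop)
    (A₀ : (E.thetaFrobenioid α h).category)
    (hA₀ : PreFrobenioid.IsFrobeniusTrivial (E.thetaFrobenioid α h).toElem A₀) (hA₀' : IG A₀.base)
    (h34 : FrdI.Thm34ii.{w, v, max v w, max u v, max (max u v) w})
    (hBmon : IsMonoidOn (E.thetaFrobenioid α h).ratFnFunctor) (hW : IsSlim DW) (hWf : IsOfFSMType DW)
    (hshape : (toDW α).Full ∧ (toDW α).Faithful ∧
      ∃ 𝒟 : DW, ∀ Y : DW, (∃ Z : Dα α, Nonempty ((toDW α).obj Z ≅ Y)) ↔ Nonempty (Y ⟶ 𝒟))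
    (hopen : IsOpen ((BiKummerSetting.mkOfModelCanonical X (E.thetaFrobenioid α h) hZ (E.isPerfect_Φα α) IG gS
      gSs NH A₀ hA₀ hA₀').Hodot : Set X.Pi))
    (hchar : ∀ Θ : Dα α ≌ Dα α, IsIsomorph (Θ.functor.obj A₀.base) A₀.base)
    (Ψ : (E.thetaFrobenioid α h).category ≌ (E.thetaFrobenioid α h).category) :
    ∃ hh : BiKummerSetting.Thm44Hyp
      (BiKummerSetting.mkOfModelCanonical X (E.thetaFrobenioid α h) hZ (E.isPerfect_Φα α) IG gS gSs NH A₀ hA₀ hA₀')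
      (BiKummerSetting.mkOfModelCanonical X (E.thetaFrobenioid α h) hZ (E.isPerfect_Φα α) IG gS gSs NH A₀ hA₀
        hA₀'), hh.Ψ = Ψ :=
  BiKummerSetting.exists_thm44Hyp_mkOfModelCanonical_treeCatVocab X (E.thetaFrobenioid α h) hZ
    (E.isPerfect_Φα α) IG gS gSs NH A₀ hA₀ hA₀' h34 hBmon (isOfFSMFFType_Dα α hWf)
    (fun Y f => E.isNonDilating_Φα α Y f) (isSlim_Dα α hW) hshape hopen hchar Ψ

end Setting

/-! ### 5. Faithfulness record: the base-shape clause "`D = D₀[𝒟]`" AS TYPED, at `D_α → D_W` -/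

section BaseShape

variable {DW : Type u} [Category.{v} DW] {A B : DW} (α : A ⟶ B)

/-- `D_α → D_W` is faithful (inclusion of a full subcategory of `(D_W)_B`, then the faithful `Over.forget`):
the clause "faithful" of `Thm44Hyp.baseShape` HOLDS at the Example 3.9 (iv) data.
[cite: MochizukiEtTh2009, Ex 3.9 p.311 (PDF p.85)] -/
theorem toDW_faithful : (toDW α).Faithful := by
  unfold toDW; infer_instance

/-- The essential image of `D_α → D_W` is `D_W[A]`, the objects admitting an arrow to `A` (the source of `α`):
the clause "essential image `= D₀[𝒟]`" of `Thm44Hyp.baseShape` HOLDS at the Example 3.9 (iv) data with `𝒟 := A`.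
[cite: MochizukiEtTh2009, Ex 3.9 p.311 (PDF p.85)] -/
theorem essImage_toDW_iff (Y : DW) : (∃ Z : Dα α, Nonempty ((toDW α).obj Z ≅ Y)) ↔ Nonempty (Y ⟶ A) := by
  constructor
  · rintro ⟨Z, ⟨e⟩⟩
    obtain ⟨k⟩ := Z.property
    exact ⟨e.inv ≫ k.left⟩
  · rintro ⟨g⟩
    exact ⟨⟨Over.mk (g ≫ α), ⟨Over.homMk g rfl⟩⟩, ⟨Iso.refl _⟩⟩

/-- The clause "essential image" in the literal shape of `Thm44Hyp.baseShape`. [cite: MochizukiEtTh2009, Ex 3.9 p.311 (PDF p.85)] -/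
theorem exists_essImage_toDW :
    ∃ 𝒟 : DW, ∀ Y : DW, (∃ Z : Dα α, Nonempty ((toDW α).obj Z ≅ Y)) ↔ Nonempty (Y ⟶ 𝒟) :=
  ⟨A, essImage_toDW_iff α⟩

/-- **The clause "full" of `Thm44Hyp.baseShape` at `D_α → D_W` forces every `D_W`-endomorphism of `A` to fix
`α`**: the object `(A, α)` of `D_α` has `End = {g | g ≫ α = α}` over `B`, and `D_α → D_W` sends it to `A`.
[cite: MochizukiEtTh2009, §4 p.312 (PDF p.86)] -/
theorem comp_eq_self_of_full_toDW (hfull : (toDW α).Full) (g : A ⟶ A) : g ≫ α = α := by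
  let Z : Dα α := ⟨Over.mk α, admitsMorphismTo_self _⟩
  obtain ⟨g', hg'⟩ := (toDW α).map_surjective (X := Z) (Y := Z) g
  have hw : g'.hom.left ≫ α = α := Over.w g'.hom
  have hmap : (toDW α).map g' = g'.hom.left := rfl
  rw [← hg', hmap]
  exact hw

/-- **At `α = 𝟙_A` — the §5 case (p. 322: "Suppose further that the morphism `α : A → B` of Example 3.9, (iv), is
the identity morphism") — the clause "full" of `Thm44Hyp.baseShape` at `D_{𝟙_A} = (D_W)_A → D_W` forces
`End_{D_W}(A) = {𝟙}`** (no non-trivial endomorphism of "`A`" over `W`); print re-bases to `D₀ := B^temp(A^log)⁰`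
there ("`D_X` … special cases of '`D_α`'", p. 311).  Faithfulness record for the owners' v-next; no statement is
changed. [cite: MochizukiEtTh2009, §5 p.322 (PDF p.96)] -/
theorem eq_id_of_full_toDW_id (hfull : (toDW (𝟙 A)).Full) (g : A ⟶ A) : g = 𝟙 A := by
  simpa using comp_eq_self_of_full_toDW (𝟙 A) hfull g

/-- Hence: if `A` has a `D_W`-endomorphism other than `𝟙_A` (e.g. a non-trivial covering transformation of `A` over
`W`), then NO `Thm44Hyp S₁ S₂` exists whose first setting lives over the Example 3.9 (iv) Frobenioid at `α = 𝟙_A`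
with the §3 reference category `D_W` — the typed base-shape clause is then unsatisfiable AS TYPED.
[cite: MochizukiEtTh2009, §4 p.312 (PDF p.86)] -/
theorem not_full_toDW_id_of_ne (g : A ⟶ A) (hg : g ≠ 𝟙 A) : ¬ (toDW (𝟙 A)).Full :=
  fun hfull => hg (eq_id_of_full_toDW_id hfull g)

end BaseShape

end Example39Data

end Literature.AnabelianGeometry.EtaleTheta
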